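import Summits.BirchSwinnertonDyer.Rank1Residual.Supersingular.X6RankZeroLeafHypotheses
import HarnessLib

/-!
# Print cell `bsd-print-x6` (leaf `ClassX6 ∧ r_an = 0`, CornersAll §1b row A6), prover p2:
# the UNIT-VALUE sub-leaf closes by name from a refereed UPPER bound and the trivial lower bound

HONEST FRAMING (cell `bsd-print-x6`, run/shared/lean/pub/bsd-print-x6/; PRINT tier D-0131 (2)).
THEOREMS ONLY — no definition, no new named fact, nothing about any particular curve is asserted,
BSD is not proved by any of this. Strategy sentence of this seat (verbatim): «Kato divisibility +
Kobayashi ± / Sprung ♯♭ control ⇒ #Ш[p^∞] ≤ the p-adic bound; close every UNIT-VALUE cell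
(ord_p(L(E,1)/Ω · ∏c_ℓ · #tor⁻²) = 0) with the trivial lower bound — no main-conjecture equality
needed». This file is the second half of that sentence, BY NAME, on the leaf predicate
`Rank1Residual.ClassX6 W p ∧ W.analyticRank = 0` (`Predicates.lean:259`; `p ≠ 2` displayed, REF
R-0.3 (a); no `¬ HasCM` binder is needed — the roads below are CM-blind, so the corner is closed as
the partition reads it and beyond).

## The sub-leaf and its closure

The UNIT-VALUE sub-leaf of A6 is `ClassX6 W p ∧ r_an = 0 ∧ ord_p #Ш(E/ℚ)_an ≤ 0` (`#Ш_an = shaAn W`,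
Miller 2011 §1; on A6, `#Ш_an = (L(E,1)/Ω_E)·#E(ℚ)_tors²/∏_ℓ c_ℓ` with `p ∤ #E(ℚ)_tors`, so the
condition reads `ord_p(L(E,1)/Ω_E) ≤ ord_p ∏_ℓ c_ℓ`; §3 gives that form too). On it Miller's
`BSD(E,p)` needs NO main-conjecture input: a refereed UPPER bound `ord_p #Ш ≤ ord_p #Ш_an`
(`Typed.MissingUpperBoundAt W p`) and the TRIVIAL lower bound `0 ≤ ord_p #Ш` squeeze
`ord_p #Ш = ord_p #Ш_an = 0` (§1, pure bookkeeping: `missingPPartAt_of_missingUpperBoundAt_of_shaAn_le`).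
Three refereed upper-bound roads are in the tree as named facts, each consumed BY NAME with its
printed hypotheses, the leaf's discharge being tree theorems (`ClassX6 = GoodSS ∧ Semistable ∧ …`;
`ClassX6.surj`, `ClassX6.irr`, Serre 1972 Props. 12 / 21 i)). Two of them are ALREADY applied on the
leaf by the cell's discharge interface (typer ty2, `Supersingular/X6RankZeroLeafHypotheses.lean`,
NOT restated here): Sprung, Adv. Math. 449 (2024) Cor. 1.2 (ii) —
`X6RankZero.missingUpperBoundAt_of_sprungCor12`, `X6RankZero.bsdp_of_sprungCor12_of_shaAn_le`
(square-free `N`, odd good supersingular `p`; NO image hypothesis; reading flag of record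
`Sprung24-Cor12ii-via-Spr12-7.16`) — and Wuthrich, Doc. Math. 19 (2014) Prop. 21 —
`X6RankZero.missingUpperBoundAt_of_wuthrich`, `X6RankZero.bsdp_of_wuthrich_of_shaAn_le` (supersingular
clause flag `R-WU14-P21-SS`). This file adds:

* §2(b) the THIRD road, Perrin-Riou, Experiment. Math. 12 (2003) Prop. 4.8 (Kato) —
  `PerrinRiou2003.prop48_padicValRat_bsd_rank_zero_le` (odd good supersingular `p`, Kato's (12.5.2),
  any `N`; flag `PR03-Prop4.8-Kato-attribution`); (12.5.2) on X6 is the tree theorem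
  `ClassX6.imageContainsSL2` (inside `Supersingular.X6.missingUpperBoundAt_of_prop48`):
  `X6.bsdp_rankZero_of_shaAn_le_of_prop48`;
* §2(a′)(b′)(c′) the SHARP form on every road: on the unit-value sub-leaf `Ш(E/ℚ)` has no
  `p`-torsion (`ord_p #Ш = 0`) and `#Ш_an` is an EXACT `p`-adic unit (never `ord_p #Ш_an < 0`) —
  `X6.padicValNat_shaOrder_eq_zero_of_shaAn_le_of_cor12 / _of_prop48 / _of_wuthrich`;
* §3 the hypothesis on the `L`-RATIO: with `L(E,1)/Ω_E = t`, `ord_p t ≤ ord_p ∏_ℓ c_ℓ` is the same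
  sub-leaf (`X6.bsdp_rankZero_of_lRatio_le_tamagawa_of_cor12`), and on the smaller zone `ord_p t ≤ 0`
  the squeeze moreover forces `p ∤ ∏_ℓ c_ℓ` and `Ш(E/ℚ)[p^∞] = 0`
  (`X6.bsdp_and_tamagawa_unit_of_lRatio_le_zero_of_cor12`).

The first half of the strategy sentence — the SAME upper bound re-derived in the kernel from
Kobayashi 2003 Thm. 4.1 (Kato's divisibility through the ± Coleman maps) + Thm. 1.2 + B. D. Kim
2013 Cor. 3.15 (exact ± control at `n = 0`) + Pollack 2003 — is the sibling file
`PrintX6KobayashiUpperHalf.lean`.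

Beyond-print theorem: NO (bookkeeping over refereed named facts; the statement "a `p`-adic unit
`#Ш_an` plus Kato's bound gives `BSD(E,p)`" is the standard remark, e.g. Miller 2011 §1).
Standing binders everywhere: GZK `rank_eq_analyticRank_of_analyticRank_le_one` (bsd.S17) and
modularity `hasEntireLFunction_rat` (for `r_an = 0 ⇔ L(E,1) ≠ 0`).

References: [Sprung2024] Cor. 1.2 (p. 4); [PerrinRiou2003] Prop. 4.8 (p. 162); [Wuthrich2014]
Prop. 21 (p. 400); [Kato2004Asterisque] Thm. 12.5 (4), (12.5.2); [Serre1972] §1.11 Prop. 12, §5.4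
Prop. 21 i); [Miller2011LMS] §1, Def. 1.1.
-/

set_option autoImplicit false
-- the landed namespace `Summit.BirchSwinnertonDyer.BirchSwinnertonDyer.Theorems` (summit = problem) trips the linter
set_option linter.dupNamespace false

noncomputable section

open scoped Classical

open WeierstrassCurve Literature.NumberTheory.EllipticCurves
  Literature.NumberTheory.EllipticCurves.Rank1Residual
  Literature.NumberTheory.EllipticCurves.Rank1Residual.Typed
  Summit.BirchSwinnertonDyer.Rank1Residual

namespace Summit.BirchSwinnertonDyer.BirchSwinnertonDyer.Theorems

variable (W : WeierstrassCurve ℚ) [W.IsElliptic] [W.IsGloballyMinimal] (p : ℕ) [Fact p.Prime]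

/-! ### §1 The squeeze (pure bookkeeping, any pair) -/

omit [W.IsElliptic] [W.IsGloballyMinimal] [Fact p.Prime] in
/-- **The trivial lower bound closes a unit-value cell.** If `ord_p #Ш ≤ ord_p #Ш_an`
(`MissingUpperBoundAt W p`) and `#Ш_an` is a rational `q` with `ord_p q ≤ 0`, then
`0 ≤ ord_p #Ш ≤ ord_p #Ш_an ≤ 0`: the whole typed output `MissingPPartAt W p` holds, `p ∤ #Ш(E/ℚ)`
(`ord_p #Ш = 0`) and `ord_p #Ш_an = 0` exactly (the rational `q` with `shaAn W = q` is unique).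
[cite: Miller2011LMS, Def. 1.1 (arXiv:1010.2431 p. 3)] -/
theorem missingPPartAt_of_missingUpperBoundAt_of_shaAn_le (hup : MissingUpperBoundAt W p)
    (hsha : ∃ q : ℚ, shaAn W = (q : ℂ) ∧ padicValRat p q ≤ 0) :
    MissingPPartAt W p ∧ padicValNat p W.shaOrder = 0 ∧
      ∃ q : ℚ, shaAn W = (q : ℂ) ∧ padicValRat p q = 0 := by
  obtain ⟨q, hq, hle⟩ := hup
  obtain ⟨q', hq', hle'⟩ := hsha
  have hqq : q' = q := by exact_mod_cast hq'.symm.trans hq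
  subst hqq
  have h0 : (0 : ℤ) ≤ padicValNat p W.shaOrder := by exact_mod_cast Nat.zero_le _
  have hsha0 : padicValNat p W.shaOrder = 0 := by
    have : (padicValNat p W.shaOrder : ℤ) ≤ 0 := hle.trans hle'
    omega
  have hq0 : padicValRat p q' = 0 := le_antisymm hle' (by rw [hsha0, Nat.cast_zero] at hle; exact hle)
  exact ⟨⟨q', hq', by rw [hq0, hsha0, Nat.cast_zero]⟩, hsha0, q', hq', hq0⟩

omit [W.IsGloballyMinimal] [Fact p.Prime] in
/-- **`BSD(E,p)` on a unit-value cell from an upper bound alone**, analytic rank `≤ 1` (GZK `hGZK`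
for `rank = r_an` and `Ш` finite): `MissingUpperBoundAt W p` and `ord_p #Ш_an ≤ 0` give Miller's
`BSDp W p`. [cite: Miller2011LMS, §1 and Def. 1.1] -/
theorem bsdp_of_missingUpperBoundAt_of_shaAn_le [Fact p.Prime]
    (hGZK : rank_eq_analyticRank_of_analyticRank_le_one) (hr : W.analyticRank ≤ 1)
    (hup : MissingUpperBoundAt W p) (hsha : ∃ q : ℚ, shaAn W = (q : ℂ) ∧ padicValRat p q ≤ 0) :
    BSDp W p :=
  bsdp_of_missingPPartAt W p hGZK hr
    (missingPPartAt_of_missingUpperBoundAt_of_shaAn_le W p hup hsha).1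

/-! ### §2 The unit-value sub-leaf of A6 by name: the Perrin-Riou road, and the sharp form on all three roads

The Sprung and Wuthrich roads are the interface theorems `X6RankZero.bsdp_of_sprungCor12_of_shaAn_le`,
`X6RankZero.bsdp_of_wuthrich_of_shaAn_le` (typer ty2, `X6RankZeroLeafHypotheses.lean`) — cited, not
restated. -/

/-- **(b) Perrin-Riou / Kato road.** On the leaf `ClassX6 W p ∧ r_an = 0` at an odd prime, a
`p`-adically non-positive `#Ш_an` (`ord_p #Ш_an ≤ 0`) gives Miller's `BSD(E,p)`, granted BY NAME
Perrin-Riou, Experiment. Math. 12 (2003) Prop. 4.8 (Kato) (`hPR`: odd good supersingular `p`, Kato's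
(12.5.2), any conductor), GZK (`hGZK`) and modularity (`hmod`). On X6 the image hypothesis (12.5.2)
is a tree THEOREM (`ClassX6.imageContainsSL2`: Serre Props. 12, 21 i), IV-23 / Wuthrich Lemma 20),
consumed inside `Supersingular.X6.missingUpperBoundAt_of_prop48`; the lower bound is the trivial one.
No CM hypothesis, no main conjecture. [cite: PerrinRiou2003, Prop. 4.8 (p. 162)]
[cite: Kato2004Asterisque, Thm. 12.5 (4), (12.5.2) (p. 222)] [cite: Miller2011LMS, Def. 1.1] -/
theorem X6.bsdp_rankZero_of_shaAn_le_of_prop48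
    (hPR : PerrinRiou2003.prop48_padicValRat_bsd_rank_zero_le)
    (hGZK : rank_eq_analyticRank_of_analyticRank_le_one) (hmod : hasEntireLFunction_rat)
    (hp : p ≠ 2) (hX : ClassX6 W p) (h0 : W.analyticRank = 0)
    (hsha : ∃ q : ℚ, shaAn W = (q : ℂ) ∧ padicValRat p q ≤ 0) : BSDp W p :=
  bsdp_of_missingUpperBoundAt_of_shaAn_le W p hGZK (by omega)
    (Supersingular.X6.missingUpperBoundAt_of_prop48 W p hPR hGZK hmod hp hX h0) hsha

/-- **(b′) Perrin-Riou road, sharp form**: on the unit-value sub-leaf `Ш(E/ℚ)` has NO `p`-torsion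
(`ord_p #Ш = 0`) and `#Ш_an` is an exact `p`-adic unit. [cite: PerrinRiou2003, Prop. 4.8 (p. 162)]
[cite: Miller2011LMS, Def. 1.1] -/
theorem X6.padicValNat_shaOrder_eq_zero_of_shaAn_le_of_prop48
    (hPR : PerrinRiou2003.prop48_padicValRat_bsd_rank_zero_le)
    (hGZK : rank_eq_analyticRank_of_analyticRank_le_one) (hmod : hasEntireLFunction_rat)
    (hp : p ≠ 2) (hX : ClassX6 W p) (h0 : W.analyticRank = 0)
    (hsha : ∃ q : ℚ, shaAn W = (q : ℂ) ∧ padicValRat p q ≤ 0) :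
    padicValNat p W.shaOrder = 0 ∧ ∃ q : ℚ, shaAn W = (q : ℂ) ∧ padicValRat p q = 0 :=
  (missingPPartAt_of_missingUpperBoundAt_of_shaAn_le W p
    (Supersingular.X6.missingUpperBoundAt_of_prop48 W p hPR hGZK hmod hp hX h0) hsha).2

/-- **(a′) Sprung road, sharp form** (upper bound = the interface theorem
`X6RankZero.missingUpperBoundAt_of_sprungCor12`, Sprung 2024 Cor. 1.2 (ii) by name): on the unit-value
sub-leaf `ord_p #Ш = 0` and `ord_p #Ш_an = 0` exactly. [cite: Sprung2024, Cor. 1.2 (p. 4), second sentence]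
[cite: Miller2011LMS, Def. 1.1] -/
theorem X6.padicValNat_shaOrder_eq_zero_of_shaAn_le_of_cor12
    (hSp : Sprung2024.cor12_padicValRat_bsd_rank_zero_le)
    (hGZK : rank_eq_analyticRank_of_analyticRank_le_one) (hmod : hasEntireLFunction_rat)
    (hp : p ≠ 2) (hX : ClassX6 W p) (h0 : W.analyticRank = 0)
    (hsha : ∃ q : ℚ, shaAn W = (q : ℂ) ∧ padicValRat p q ≤ 0) :
    padicValNat p W.shaOrder = 0 ∧ ∃ q : ℚ, shaAn W = (q : ℂ) ∧ padicValRat p q = 0 :=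
  (missingPPartAt_of_missingUpperBoundAt_of_shaAn_le W p
    (Supersingular.X6RankZero.missingUpperBoundAt_of_sprungCor12 W p hSp hGZK hmod hp hX h0) hsha).2

/-- **(c′) Wuthrich road, sharp form** (upper bound = the interface theorem
`X6RankZero.missingUpperBoundAt_of_wuthrich`, Wuthrich 2014 Prop. 21 by name, image proviso by
`ClassX6.not_irr_or_surj`): on the unit-value sub-leaf `ord_p #Ш = 0` and `ord_p #Ш_an = 0` exactly.
[cite: Wuthrich2014, Prop. 21 (p. 400)] [cite: Miller2011LMS, Def. 1.1] -/
theorem X6.padicValNat_shaOrder_eq_zero_of_shaAn_le_of_wuthrich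
    (hW : Wuthrich2014.sha_dvd_analyticSha)
    (hGZK : rank_eq_analyticRank_of_analyticRank_le_one) (hmod : hasEntireLFunction_rat)
    (hp : p ≠ 2) (hX : ClassX6 W p) (h0 : W.analyticRank = 0)
    (hsha : ∃ q : ℚ, shaAn W = (q : ℂ) ∧ padicValRat p q ≤ 0) :
    padicValNat p W.shaOrder = 0 ∧ ∃ q : ℚ, shaAn W = (q : ℂ) ∧ padicValRat p q = 0 :=
  (missingPPartAt_of_missingUpperBoundAt_of_shaAn_le W p
    (Supersingular.X6RankZero.missingUpperBoundAt_of_wuthrich W p hW hGZK hmod hp hX h0) hsha).2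

/-! ### §3 The same sub-leaf on the `L`-ratio `t = L(E,1)/Ω_E` -/

omit [W.IsGloballyMinimal] in
/-- Bookkeeping on A6-type pairs: in analytic rank `0` with `E[p]` irreducible and
`L(E,1)/Ω_E = t`, `#Ш_an = t·#E(ℚ)_tors²/∏c_ℓ` with `ord_p #Ш_an = ord_p t − ord_p ∏_ℓ c_ℓ`
(`p ∤ #E(ℚ)_tors`); so `ord_p t ≤ ord_p ∏_ℓ c_ℓ` is exactly `ord_p #Ш_an ≤ 0`.
[cite: Miller2011LMS, §1 (arXiv:1010.2431 p. 3)] -/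
theorem shaAn_le_zero_of_lRatio_le_tamagawa
    (hGZK : rank_eq_analyticRank_of_analyticRank_le_one) (hmod : hasEntireLFunction_rat)
    (hirr : W.HasIrreducibleModPGaloisRep p) (h0 : W.analyticRank = 0) {t : ℚ}
    (ht : W.entireLFunction 1 / (W.realPeriodRat : ℂ) = (t : ℂ))
    (hv : padicValRat p t ≤ padicValNat p W.tamagawaProduct) :
    ∃ q : ℚ, shaAn W = (q : ℂ) ∧ padicValRat p q ≤ 0 := by
  have hL : W.entireLFunction 1 ≠ 0 := (W.analyticRank_eq_zero_iff_holds (hmod W)).1 h0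
  have ht0 : t ≠ 0 := by
    rintro rfl
    apply hL
    have hΩ : (W.realPeriodRat : ℂ) ≠ 0 := by exact_mod_cast W.realPeriodRat_pos_holds.ne'
    have h1 := ht
    rw [Rat.cast_zero, div_eq_zero_iff] at h1
    exact h1.resolve_right hΩ
  refine ⟨_, Supersingular.shaAn_eq_of_analyticRank_eq_zero W hGZK h0 ht, ?_⟩
  rw [Supersingular.padicValRat_shaAn_witness W p hirr ht0]
  linarith

/-- **The sub-leaf on the `L`-ratio (Sprung road).** On `ClassX6 W p ∧ r_an = 0`, `p` odd, with
`L(E,1)/Ω_E = t` and `ord_p t ≤ ord_p ∏_ℓ c_ℓ` (the UNIT-VALUE condition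
`ord_p((L(E,1)/Ω_E)·#E(ℚ)_tors²/∏c_ℓ) ≤ 0`, torsion being prime to `p` by `ClassX6.irr`):
Miller's `BSD(E,p)`, granted Sprung 2024 Cor. 1.2 (ii), GZK, modularity by name.
[cite: Sprung2024, Cor. 1.2 (p. 4), second sentence] [cite: Serre1972, §1.11 Prop. 12] [cite: Miller2011LMS, Def. 1.1] -/
theorem X6.bsdp_rankZero_of_lRatio_le_tamagawa_of_cor12
    (hSp : Sprung2024.cor12_padicValRat_bsd_rank_zero_le)
    (hGZK : rank_eq_analyticRank_of_analyticRank_le_one) (hmod : hasEntireLFunction_rat)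
    (hp : p ≠ 2) (hX : ClassX6 W p) (h0 : W.analyticRank = 0) {t : ℚ}
    (ht : W.entireLFunction 1 / (W.realPeriodRat : ℂ) = (t : ℂ))
    (hv : padicValRat p t ≤ padicValNat p W.tamagawaProduct) : BSDp W p :=
  Supersingular.X6RankZero.bsdp_of_sprungCor12_of_shaAn_le W p hSp hGZK hmod hp hX h0
    (shaAn_le_zero_of_lRatio_le_tamagawa W p hGZK hmod (ClassX6.irr W p hp hX) h0 ht hv)

/-- **The `L`-value unit zone (Sprung road): `ord_p(L(E,1)/Ω_E) ≤ 0` on `ClassX6 ∧ r_an = 0`, `p`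
odd ⇒ `BSD(E,p)`, `p ∤ #Ш(E/ℚ)` AND `p ∤ ∏_ℓ c_ℓ`.** The squeeze reads
`0 ≤ ord_p #Ш ≤ ord_p #Ш_an = ord_p t − ord_p ∏c_ℓ ≤ −ord_p ∏c_ℓ ≤ 0`, so every term vanishes: at a
unit `L`-value an A6 pair has `p`-trivial `Ш` and `p`-trivial Tamagawa product (the printed shape of
Kurihara's / Kato's unit-value corollary, here from Sprung's one-sided Cor. 1.2 by name).
[cite: Sprung2024, Cor. 1.2 (p. 4), second sentence] [cite: Serre1972, §1.11 Prop. 12] [cite: Miller2011LMS, Def. 1.1] -/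
theorem X6.bsdp_and_tamagawa_unit_of_lRatio_le_zero_of_cor12
    (hSp : Sprung2024.cor12_padicValRat_bsd_rank_zero_le)
    (hGZK : rank_eq_analyticRank_of_analyticRank_le_one) (hmod : hasEntireLFunction_rat)
    (hp : p ≠ 2) (hX : ClassX6 W p) (h0 : W.analyticRank = 0) {t : ℚ}
    (ht : W.entireLFunction 1 / (W.realPeriodRat : ℂ) = (t : ℂ)) (hv : padicValRat p t ≤ 0) :
    BSDp W p ∧ padicValNat p W.shaOrder = 0 ∧ padicValNat p W.tamagawaProduct = 0 ∧
      padicValRat p t = 0 := by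
  have hirr : W.HasIrreducibleModPGaloisRep p := ClassX6.irr W p hp hX
  have hL : W.entireLFunction 1 ≠ 0 := (W.analyticRank_eq_zero_iff_holds (hmod W)).1 h0
  have ht0 : t ≠ 0 := by
    rintro rfl
    apply hL
    have hΩ : (W.realPeriodRat : ℂ) ≠ 0 := by exact_mod_cast W.realPeriodRat_pos_holds.ne'
    have h1 := ht
    rw [Rat.cast_zero, div_eq_zero_iff] at h1
    exact h1.resolve_right hΩ
  have hc0 : (0 : ℤ) ≤ padicValNat p W.tamagawaProduct := by exact_mod_cast Nat.zero_le _
  have hsha : ∃ q : ℚ, shaAn W = (q : ℂ) ∧ padicValRat p q ≤ 0 :=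
    shaAn_le_zero_of_lRatio_le_tamagawa W p hGZK hmod hirr h0 ht (hv.trans hc0)
  have hup : MissingUpperBoundAt W p :=
    Supersingular.X6RankZero.missingUpperBoundAt_of_sprungCor12 W p hSp hGZK hmod hp hX h0
  obtain ⟨hPP, hsha0, q, hq, hq0⟩ := missingPPartAt_of_missingUpperBoundAt_of_shaAn_le W p hup hsha
  -- the unique rational value of `#Ш_an` is `t·#tors²/∏c`, of valuation `ord_p t − ord_p ∏c`
  have hq' : shaAn W = ((t * (W.torsionOrder : ℚ) ^ 2 / (W.tamagawaProduct : ℚ) : ℚ) : ℂ) :=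
    Supersingular.shaAn_eq_of_analyticRank_eq_zero W hGZK h0 ht
  have hqq : q = t * (W.torsionOrder : ℚ) ^ 2 / (W.tamagawaProduct : ℚ) := by
    exact_mod_cast hq.symm.trans hq'
  rw [hqq, Supersingular.padicValRat_shaAn_witness W p hirr ht0] at hq0
  refine ⟨bsdp_of_missingPPartAt W p hGZK (by omega) hPP, hsha0, ?_, by linarith⟩
  have : (padicValNat p W.tamagawaProduct : ℤ) = 0 := by linarith
  exact_mod_cast this

end Summit.BirchSwinnertonDyer.BirchSwinnertonDyer.Theorems

end
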